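import Summits.AtomisticToContinuum.Crystallization.Theorems.FreeSplittingCertificatesStrictSplittingRuleP1Reproduce
import Summits.AtomisticToContinuum.Crystallization.Theorems.FreeSplittingCertificatesStrictSplittingRuleP1CellVarianceF

/-!
# `StrictSplittingRule` (stmt-AtomisticToContinuum-12560): the vertex-quadrature defect in CIRCUMRADIUS form — `defect_T ≤ (∫_T ω)·ρ_T·|G_T|²` — and its global sum (P1 interpolant object, part 31)

Route `FreeSplittingCertificates`, crux r3 `StrictSplittingRule` (H12⋆ = `stub_coreJointCoercive`), unit b2b-freesplit-B gen 24.
VALUE = the sharpest inner-edge form of the demand-side defect (HOME FAR-LEMMA-SPEC §17 (h)).  Part 28 bounds the defect of the vertex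
quadrature on a cell `T` by `¼(∫_T ω)·Σ_{m<m'}|v_m − v_{m'}|²` (using only `λ_mλ_{m'} ≤ ¼`); for P1 vertex values (`v_m − v_{m'} = G_Tᵀ(y_m − y_{m'})`)
the edge sum is a quadratic form in `G_T` whose sharp constant needs a per-cell-type eigenvalue bound (`2a²` tetrahedra, `4a²` octahedron
quarters at the ideal ratio).  Here instead the barycentric weights are KEPT: pointwise on the cell
`½Σ_{m,m'}λ_mλ_{m'}|G_Tᵀ(y_m − y_{m'})|² ≤ |G_T|²·½Σ_{m,m'}λ_mλ_{m'}|y_m − y_{m'}|² = |G_T|²·Σ_mλ_m|y_m − y|² ≤ |G_T|²·ρ_T`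
(variance identity for `|·|²` + barycentric reproduction `Σλ_m y_m = y`, part 30, + `Σ_mλ_m|y_m − y|² = Σ_mλ_m|y_m − c|² − |y − c|² ≤ ρ_T` for
any centre `c` with the four vertices within `|·|² ≤ ρ_T` of it — `ρ_T` = squared circumradius: `3a²/8` tetrahedra, `a²/2` octahedron quarters at the
ideal ratio, i.e. HALF of `¼·λ_max`):
* `fpSq_vecMul_le` — `|Gᵀe|² ≤ |e|²|G|²`;
* `p1_defect_pointwise_rad` — the pointwise bound above;
* **`vertex_quadrature_excess_rad_p1RealCell`** — `Σ_m∫_Tλ_m q_W(v_m) ≤ ∫_T q_W(ṽ) + (∫_T ω)·ρ_T·|G_T|²`;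
* **`tsum_p1SiteBare_le_rad`** — the global sum `Σ'_q p1SiteBare q ≤ ∫ q_W(ṽ) + Σ'_T (∫_T ω)·ρ_T·|G_T|²` for lattice values `V`
  (`G_T = p1CellGrad a h V T`, vertex differences by `p1CellGrad_vertex_sub`).
With `ω = 2χ²|y|⁻⁸ ≤ 2r_min(T)⁻²·χ²|y|⁻⁶` this charges the defect to the readout inflation with `Δf = 48ρ_T/(a² r_min²)·a²` per cell
(`= 24(a/r_min)²` quarters, `18(a/r_min)²` tetrahedra).  NOT a proof of H12⋆, NOT summit progress.  [folklore]
-/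

noncomputable section

open Set Function Metric MeasureTheory Filter Topology
open scoped BigOperators NNReal ENNReal

namespace Summit.AtomisticToContinuum.Crystallization.Theorems.StrictSplittingRuleBirth

open Literature.MathematicalPhysics.StatisticalMechanics
open Summit.AtomisticToContinuum.Crystallization.Theorems.PalmUnimodularRigidity.LayeredLawsSelectHcp

/-! ## Pointwise algebra -/

/-- **Cauchy–Schwarz for `Gᵀe`**: `|Gᵀe|² ≤ |e|²·|G|²_F` (Lagrange's identity, column by column). -/
theorem fpSq_vecMul_le (e : Fin 3 → ℝ) (G : Fin 3 → Fin 3 → ℝ) :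
    fpSq (fun k => e 0 * G 0 k + e 1 * G 1 k + e 2 * G 2 k) ≤ fpSq e * fpFrob G := by
  have hid : fpSq e * fpFrob G - fpSq (fun k => e 0 * G 0 k + e 1 * G 1 k + e 2 * G 2 k) =
      ((e 0 * G 1 0 - e 1 * G 0 0) ^ 2 + (e 0 * G 2 0 - e 2 * G 0 0) ^ 2 + (e 1 * G 2 0 - e 2 * G 1 0) ^ 2) +
      ((e 0 * G 1 1 - e 1 * G 0 1) ^ 2 + (e 0 * G 2 1 - e 2 * G 0 1) ^ 2 + (e 1 * G 2 1 - e 2 * G 1 1) ^ 2) +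
      ((e 0 * G 1 2 - e 1 * G 0 2) ^ 2 + (e 0 * G 2 2 - e 2 * G 0 2) ^ 2 + (e 1 * G 2 2 - e 2 * G 1 2) ^ 2) := by
    unfold fpSq fpFrob; ring
  nlinarith [hid, sq_nonneg (e 0 * G 1 0 - e 1 * G 0 0), sq_nonneg (e 0 * G 2 0 - e 2 * G 0 0), sq_nonneg (e 1 * G 2 0 - e 2 * G 1 0),
    sq_nonneg (e 0 * G 1 1 - e 1 * G 0 1), sq_nonneg (e 0 * G 2 1 - e 2 * G 0 1), sq_nonneg (e 1 * G 2 1 - e 2 * G 1 1),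
    sq_nonneg (e 0 * G 1 2 - e 1 * G 0 2), sq_nonneg (e 0 * G 2 2 - e 2 * G 0 2), sq_nonneg (e 1 * G 2 2 - e 2 * G 1 2)]

/-- `fpSq` of a coordinate function equals the sum of squares (bridge to the `u 0 ^ 2 + u 1 ^ 2 + u 2 ^ 2` form of the majorants). -/
theorem fpSq_eq_sum_sq (u : Fin 3 → ℝ) : fpSq u = u 0 ^ 2 + u 1 ^ 2 + u 2 ^ 2 := rfl

/-- **The barycentric edge second moment is the second moment about the point**: on the cell,
`½Σ_{m,m'}λ_mλ_{m'}|y_m − y_{m'}|² = Σ_mλ_m|y_m − y|²` (variance identity for `|·|²` + reproduction `Σ_mλ_m y_m = y`). -/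
theorem p1_edge_second_moment_eq {a h : ℝ} (ha : a ≠ 0) (hh : h ≠ 0) {i : (ℤ × ℤ × ℤ) × Fin 6} {y : Fin 3 → ℝ}
    (hy : y ∈ p1RealCell a h i) :
    1 / 2 * ∑ m : Fin 4, ∑ m' : Fin 4, p1Lam a h i m y * p1Lam a h i m' y *
        fpSq (fun k => hcpSite a h (i.1 + p1VertOff (p1Par i.1) i.2 m) k - hcpSite a h (i.1 + p1VertOff (p1Par i.1) i.2 m') k) =
      ∑ m : Fin 4, p1Lam a h i m y * fpSq (fun k => hcpSite a h (i.1 + p1VertOff (p1Par i.1) i.2 m) k - y k) := by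
  have hvar := p1_variance_identity (fun k l => if k = l then (1 : ℝ) else 0) (fun m => p1Lam a h i m y) (sum_p1Lam_eq_one a h i y)
    (fun m k => hcpSite a h (i.1 + p1VertOff (p1Par i.1) i.2 m) k)
  simp only [p1Quad3_one] at hvar
  have hrep : (fun k => ∑ m : Fin 4, p1Lam a h i m y * hcpSite a h (i.1 + p1VertOff (p1Par i.1) i.2 m) k) = y :=
    sum_p1Lam_smul_hcpSite ha hh hy
  have hrep' : ∀ k, ∑ m : Fin 4, p1Lam a h i m y * hcpSite a h (i.1 + p1VertOff (p1Par i.1) i.2 m) k = y k :=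
    fun k => congrFun hrep k
  rw [hrep' 0, hrep' 1, hrep' 2] at hvar
  have hc := sum_p1Lam_mul_fpSq_sub ha hh hy 0
  simp only [Pi.zero_apply, sub_zero] at hc
  simp only [Pi.sub_apply] at hvar
  simp only [fpSq] at hc ⊢
  rw [hc, ← hvar]

/-- **Pointwise circumradius bound of the P1 defect**: on the cell, for `0 ≤ q_{W(y)}(u) ≤ ω(y)|u|²`, vertex values with
`v_m − v_{m'} = Gᵀ(y_m − y_{m'})`, and all four vertices within `|·|² ≤ ρ` of some centre `c`:
`½Σ_{m,m'}λ_m(y)λ_{m'}(y)·q_{W(y)}(v_m − v_{m'}) ≤ ω(y)·ρ·|G|²`. -/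
theorem p1_defect_pointwise_rad {a h : ℝ} (ha : a ≠ 0) (hh : h ≠ 0) {i : (ℤ × ℤ × ℤ) × Fin 6} {y : Fin 3 → ℝ}
    (hy : y ∈ p1RealCell a h i) (Wy : Fin 3 → Fin 3 → ℝ) (hW0 : ∀ u : Fin 3 → ℝ, 0 ≤ p1Quad3 Wy u) {ωy : ℝ}
    (hω : ∀ u : Fin 3 → ℝ, p1Quad3 Wy u ≤ ωy * (u 0 ^ 2 + u 1 ^ 2 + u 2 ^ 2)) (G : Fin 3 → Fin 3 → ℝ) (v : Fin 4 → Fin 3 → ℝ)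
    (hv : ∀ m m' : Fin 4, ∀ k : Fin 3, v m k - v m' k =
      (hcpSite a h (i.1 + p1VertOff (p1Par i.1) i.2 m) 0 - hcpSite a h (i.1 + p1VertOff (p1Par i.1) i.2 m') 0) * G 0 k +
      (hcpSite a h (i.1 + p1VertOff (p1Par i.1) i.2 m) 1 - hcpSite a h (i.1 + p1VertOff (p1Par i.1) i.2 m') 1) * G 1 k +
      (hcpSite a h (i.1 + p1VertOff (p1Par i.1) i.2 m) 2 - hcpSite a h (i.1 + p1VertOff (p1Par i.1) i.2 m') 2) * G 2 k)
    {c : Fin 3 → ℝ} {ρ : ℝ} (hρ : ∀ m : Fin 4, fpSq (fun k => hcpSite a h (i.1 + p1VertOff (p1Par i.1) i.2 m) k - c k) ≤ ρ) :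
    1 / 2 * ∑ m : Fin 4, ∑ m' : Fin 4, p1Lam a h i m y * p1Lam a h i m' y * p1Quad3 Wy (v m - v m') ≤ ωy * ρ * fpFrob G := by
  -- `ω ≥ 0`
  have hω0 : 0 ≤ ωy := by
    have h1 := hW0 (fun k => if k = 0 then 1 else 0)
    have h2 := hω (fun k => if k = 0 then 1 else 0)
    simp at h2
    linarith
  have hG0 : 0 ≤ fpFrob G := by unfold fpFrob; positivity
  -- termwise domination
  have hterm : ∀ m m' : Fin 4, p1Lam a h i m y * p1Lam a h i m' y * p1Quad3 Wy (v m - v m') ≤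
      p1Lam a h i m y * p1Lam a h i m' y *
        fpSq (fun k => hcpSite a h (i.1 + p1VertOff (p1Par i.1) i.2 m) k - hcpSite a h (i.1 + p1VertOff (p1Par i.1) i.2 m') k) *
        (ωy * fpFrob G) := by
    intro m m'
    have hl := mul_nonneg (p1Lam_nonneg_of_mem hy m) (p1Lam_nonneg_of_mem hy m')
    have hb := hω (v m - v m')
    simp only [Pi.sub_apply] at hb
    have hcs := fpSq_vecMul_le (fun k => hcpSite a h (i.1 + p1VertOff (p1Par i.1) i.2 m) k -
      hcpSite a h (i.1 + p1VertOff (p1Par i.1) i.2 m') k) G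
    have heq : (v m 0 - v m' 0) ^ 2 + (v m 1 - v m' 1) ^ 2 + (v m 2 - v m' 2) ^ 2 =
        fpSq (fun k => (hcpSite a h (i.1 + p1VertOff (p1Par i.1) i.2 m) 0 - hcpSite a h (i.1 + p1VertOff (p1Par i.1) i.2 m') 0) * G 0 k +
          (hcpSite a h (i.1 + p1VertOff (p1Par i.1) i.2 m) 1 - hcpSite a h (i.1 + p1VertOff (p1Par i.1) i.2 m') 1) * G 1 k +
          (hcpSite a h (i.1 + p1VertOff (p1Par i.1) i.2 m) 2 - hcpSite a h (i.1 + p1VertOff (p1Par i.1) i.2 m') 2) * G 2 k) := by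
      rw [fpSq_eq_sum_sq, ← hv m m' 0, ← hv m m' 1, ← hv m m' 2]
    rw [heq] at hb
    calc p1Lam a h i m y * p1Lam a h i m' y * p1Quad3 Wy (v m - v m')
        ≤ p1Lam a h i m y * p1Lam a h i m' y * (ωy * (fpSq (fun k => hcpSite a h (i.1 + p1VertOff (p1Par i.1) i.2 m) k -
            hcpSite a h (i.1 + p1VertOff (p1Par i.1) i.2 m') k) * fpFrob G)) :=
          mul_le_mul_of_nonneg_left (hb.trans (mul_le_mul_of_nonneg_left hcs hω0)) hl
      _ = _ := by ring
  have hs := Finset.sum_le_sum fun m (_ : m ∈ Finset.univ) => Finset.sum_le_sum fun m' (_ : m' ∈ Finset.univ) => hterm m m'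
  have hmom := p1_edge_second_moment_eq ha hh hy
  have hle := sum_p1Lam_mul_fpSq_le ha hh hy hρ
  calc 1 / 2 * ∑ m : Fin 4, ∑ m' : Fin 4, p1Lam a h i m y * p1Lam a h i m' y * p1Quad3 Wy (v m - v m')
      ≤ 1 / 2 * ∑ m : Fin 4, ∑ m' : Fin 4, p1Lam a h i m y * p1Lam a h i m' y *
          fpSq (fun k => hcpSite a h (i.1 + p1VertOff (p1Par i.1) i.2 m) k - hcpSite a h (i.1 + p1VertOff (p1Par i.1) i.2 m') k) *
          (ωy * fpFrob G) := mul_le_mul_of_nonneg_left hs (by norm_num)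
    _ = (1 / 2 * ∑ m : Fin 4, ∑ m' : Fin 4, p1Lam a h i m y * p1Lam a h i m' y *
          fpSq (fun k => hcpSite a h (i.1 + p1VertOff (p1Par i.1) i.2 m) k - hcpSite a h (i.1 + p1VertOff (p1Par i.1) i.2 m') k)) *
          (ωy * fpFrob G) := by
        have e : ∀ m m' : Fin 4, p1Lam a h i m y * p1Lam a h i m' y *
            fpSq (fun k => hcpSite a h (i.1 + p1VertOff (p1Par i.1) i.2 m) k - hcpSite a h (i.1 + p1VertOff (p1Par i.1) i.2 m') k) *
            (ωy * fpFrob G) = (ωy * fpFrob G) * (p1Lam a h i m y * p1Lam a h i m' y *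
            fpSq (fun k => hcpSite a h (i.1 + p1VertOff (p1Par i.1) i.2 m) k - hcpSite a h (i.1 + p1VertOff (p1Par i.1) i.2 m') k)) :=
          fun m m' => by ring
        simp_rw [e, ← Finset.mul_sum]
        ring
    _ = (∑ m : Fin 4, p1Lam a h i m y * fpSq (fun k => hcpSite a h (i.1 + p1VertOff (p1Par i.1) i.2 m) k - y k)) * (ωy * fpFrob G) := by
        rw [hmom]
    _ ≤ ρ * (ωy * fpFrob G) := mul_le_mul_of_nonneg_right hle (mul_nonneg hω0 hG0)
    _ = ωy * ρ * fpFrob G := by ring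

/-! ## The cell inequality -/

/-- **THE VERTEX-QUADRATURE EXCESS IN CIRCUMRADIUS FORM** (`0 ⪯ W(y)`, pointwise majorant `q_{W(y)}(u) ≤ ω(y)|u|²`, `ω` continuous; P1 vertex
values `v_m − v_{m'} = Gᵀ(y_m − y_{m'})`; vertices within `|·|² ≤ ρ` of a centre `c`):
`Σ_m ∫_T λ_m·q_W(v_m) ≤ ∫_T q_W(ṽ) + (∫_T ω)·ρ·|G|²_F`.  NOT a proof of H12⋆, NOT summit progress. -/
theorem vertex_quadrature_excess_rad_p1RealCell {a h : ℝ} (ha : 0 < a) (hh : 0 < h) (i : (ℤ × ℤ × ℤ) × Fin 6)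
    (W : (Fin 3 → ℝ) → Fin 3 → Fin 3 → ℝ) (hWc : ∀ k l, Continuous fun x => W x k l)
    (hW0 : ∀ y ∈ p1RealCell a h i, ∀ u : Fin 3 → ℝ, 0 ≤ p1Quad3 (W y) u) {ω : (Fin 3 → ℝ) → ℝ} (hωc : Continuous ω)
    (hω : ∀ y ∈ p1RealCell a h i, ∀ u : Fin 3 → ℝ, p1Quad3 (W y) u ≤ ω y * (u 0 ^ 2 + u 1 ^ 2 + u 2 ^ 2))
    (G : Fin 3 → Fin 3 → ℝ) (v : Fin 4 → Fin 3 → ℝ)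
    (hv : ∀ m m' : Fin 4, ∀ k : Fin 3, v m k - v m' k =
      (hcpSite a h (i.1 + p1VertOff (p1Par i.1) i.2 m) 0 - hcpSite a h (i.1 + p1VertOff (p1Par i.1) i.2 m') 0) * G 0 k +
      (hcpSite a h (i.1 + p1VertOff (p1Par i.1) i.2 m) 1 - hcpSite a h (i.1 + p1VertOff (p1Par i.1) i.2 m') 1) * G 1 k +
      (hcpSite a h (i.1 + p1VertOff (p1Par i.1) i.2 m) 2 - hcpSite a h (i.1 + p1VertOff (p1Par i.1) i.2 m') 2) * G 2 k)
    {c : Fin 3 → ℝ} {ρ : ℝ} (hρ : ∀ m : Fin 4, fpSq (fun k => hcpSite a h (i.1 + p1VertOff (p1Par i.1) i.2 m) k - c k) ≤ ρ) :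
    ∑ m, ∫ y in p1RealCell a h i, p1Lam a h i m y * p1Quad3 (W y) (v m) ≤
      (∫ y in p1RealCell a h i, p1Quad3 (W y) (fun k => ∑ m, p1Lam a h i m y * v m k)) +
        (∫ y in p1RealCell a h i, ω y) * (ρ * fpFrob G) := by
  have ha' := ha.ne'
  have hh' := hh.ne'
  have hK := isCompact_p1RealCell ha' hh' i
  have hmeas : MeasurableSet (p1RealCell a h i) := (isClosed_p1RealCell a h i).measurableSet
  have hcl : ∀ m, Continuous (p1Lam a h i m) := continuous_p1Lam a h i
  have hq : ∀ u : Fin 3 → ℝ, Continuous fun y => p1Quad3 (W y) u := fun u =>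
    continuous_p1Quad3_of_continuous hWc (u := fun _ => u) fun k => continuous_const
  -- integrability
  have iA : ∀ m, IntegrableOn (fun y => p1Lam a h i m y * p1Quad3 (W y) (v m)) (p1RealCell a h i) volume := fun m =>
    ((hcl m).mul (hq _)).continuousOn.integrableOn_compact hK
  have iB : ∀ m m', IntegrableOn (fun y => p1Lam a h i m y * p1Lam a h i m' y * p1Quad3 (W y) (v m - v m')) (p1RealCell a h i) volume :=
    fun m m' => (((hcl m).mul (hcl m')).mul (hq _)).continuousOn.integrableOn_compact hK
  have iQ : IntegrableOn (fun y => p1Quad3 (W y) (fun k => ∑ m, p1Lam a h i m y * v m k)) (p1RealCell a h i) volume := by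
    have : Continuous fun y => p1Quad3 (W y) (fun k => ∑ m, p1Lam a h i m y * v m k) := by
      refine continuous_p1Quad3_of_continuous hWc fun k => ?_
      simp only [Fin.sum_univ_four]
      fun_prop
    exact this.continuousOn.integrableOn_compact hK
  have iS : IntegrableOn (fun y => ∑ m, p1Lam a h i m y * p1Quad3 (W y) (v m)) (p1RealCell a h i) volume :=
    integrable_finsetSum _ fun m _ => iA m
  have iD : IntegrableOn (fun y => 1 / 2 * ∑ m, ∑ m', p1Lam a h i m y * p1Lam a h i m' y * p1Quad3 (W y) (v m - v m'))
      (p1RealCell a h i) volume :=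
    (integrable_finsetSum _ fun m _ => integrable_finsetSum _ fun m' _ => iB m m').const_mul _
  have iω : IntegrableOn (fun y => ω y * (ρ * fpFrob G)) (p1RealCell a h i) volume :=
    (hωc.mul continuous_const).continuousOn.integrableOn_compact hK
  -- pointwise variance identity
  have hpt : ∀ y, (∑ m, p1Lam a h i m y * p1Quad3 (W y) (v m)) - p1Quad3 (W y) (fun k => ∑ m, p1Lam a h i m y * v m k) =
      1 / 2 * ∑ m, ∑ m', p1Lam a h i m y * p1Lam a h i m' y * p1Quad3 (W y) (v m - v m') :=
    fun y => p1_variance_identity (W y) (fun m => p1Lam a h i m y) (sum_p1Lam_eq_one a h i y) v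
  -- pointwise domination of the defect
  have hdom : ∀ y ∈ p1RealCell a h i,
      1 / 2 * ∑ m, ∑ m', p1Lam a h i m y * p1Lam a h i m' y * p1Quad3 (W y) (v m - v m') ≤ ω y * (ρ * fpFrob G) := by
    intro y hy
    have h := p1_defect_pointwise_rad ha' hh' hy (W y) (hW0 y hy) (hω y hy) G v hv hρ
    linarith
  have hD : ∫ y in p1RealCell a h i, 1 / 2 * ∑ m, ∑ m', p1Lam a h i m y * p1Lam a h i m' y * p1Quad3 (W y) (v m - v m') ≤
      (∫ y in p1RealCell a h i, ω y) * (ρ * fpFrob G) := by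
    refine (setIntegral_mono_on iD iω hmeas hdom).trans (le_of_eq ?_)
    rw [integral_mul_const]
  have hdiff : (∫ y in p1RealCell a h i, ∑ m, p1Lam a h i m y * p1Quad3 (W y) (v m)) -
      ∫ y in p1RealCell a h i, p1Quad3 (W y) (fun k => ∑ m, p1Lam a h i m y * v m k) =
      ∫ y in p1RealCell a h i, 1 / 2 * ∑ m, ∑ m', p1Lam a h i m y * p1Lam a h i m' y * p1Quad3 (W y) (v m - v m') := by
    rw [← integral_sub iS iQ]
    exact setIntegral_congr_fun hmeas fun y _ => hpt y
  rw [← integral_finsetSum _ fun m _ => iA m]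
  linarith [hD, hdiff]

/-! ## The global sum -/

/-- The vertex values of a lattice function on a cell satisfy the P1 vertex-difference identity with the cell gradient. -/
theorem p1CellVals_sub_eq_grad {a h : ℝ} (ha : a ≠ 0) (hh : h ≠ 0) (V : ℤ × ℤ × ℤ → (Fin 3 → ℝ)) (i : (ℤ × ℤ × ℤ) × Fin 6)
    (m m' : Fin 4) (k : Fin 3) :
    p1CellVals V i m k - p1CellVals V i m' k =
      (hcpSite a h (i.1 + p1VertOff (p1Par i.1) i.2 m) 0 - hcpSite a h (i.1 + p1VertOff (p1Par i.1) i.2 m') 0) * p1CellGrad a h V i 0 k +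
      (hcpSite a h (i.1 + p1VertOff (p1Par i.1) i.2 m) 1 - hcpSite a h (i.1 + p1VertOff (p1Par i.1) i.2 m') 1) * p1CellGrad a h V i 1 k +
      (hcpSite a h (i.1 + p1VertOff (p1Par i.1) i.2 m) 2 - hcpSite a h (i.1 + p1VertOff (p1Par i.1) i.2 m') 2) * p1CellGrad a h V i 2 k := by
  have h := p1CellGrad_vertex_sub ha hh V i m m' k
  simpa [p1CellVals, Pi.sub_apply] using h

/-- **THE GLOBAL BARE-DEMAND TRANSFER IN CIRCUMRADIUS FORM (matched split, radial-deficit half).**  For a continuous weight `0 ⪯ W(y)`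
with a continuous pointwise majorant `q_{W(y)}(u) ≤ ω(y)|u|²`, lattice values `V` with interpolant `ṽ = p1Field a h V` and cell gradients
`G_T = p1CellGrad a h V T`, centres `c_T` and radii with all four vertices of `T` within `|·|² ≤ ρ_T` of `c_T`, assuming `q_W(ṽ)` integrable and the
defect family summable:
`Σ'_q p1SiteBare q ≤ ∫ q_W(ṽ) + Σ'_T (∫_T ω)·ρ_T·|G_T|²_F`.  NOT a proof of H12⋆, NOT summit progress. -/
theorem tsum_p1SiteBare_le_rad {a h : ℝ} (ha : 0 < a) (hh : 0 < h) (W : (Fin 3 → ℝ) → Fin 3 → Fin 3 → ℝ)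
    (hWc : ∀ k l, Continuous fun x => W x k l) (hW0 : ∀ y : Fin 3 → ℝ, ∀ u : Fin 3 → ℝ, 0 ≤ p1Quad3 (W y) u)
    {ω : (Fin 3 → ℝ) → ℝ} (hωc : Continuous ω)
    (hω : ∀ y : Fin 3 → ℝ, ∀ u : Fin 3 → ℝ, p1Quad3 (W y) u ≤ ω y * (u 0 ^ 2 + u 1 ^ 2 + u 2 ^ 2))
    (V : ℤ × ℤ × ℤ → (Fin 3 → ℝ)) (hint : Integrable fun y => p1Quad3 (W y) (p1Field a h V y))
    (c : (ℤ × ℤ × ℤ) × Fin 6 → Fin 3 → ℝ) (ρ : (ℤ × ℤ × ℤ) × Fin 6 → ℝ)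
    (hρ : ∀ i, ∀ m : Fin 4, fpSq (fun k => hcpSite a h (i.1 + p1VertOff (p1Par i.1) i.2 m) k - c i k) ≤ ρ i)
    (hdef : Summable fun i => (∫ y in p1RealCell a h i, ω y) * (ρ i * fpFrob (p1CellGrad a h V i))) :
    Summable (p1SiteBare a h W V) ∧
    ∑' q, p1SiteBare a h W V q ≤
      (∫ y, p1Quad3 (W y) (p1Field a h V y)) + ∑' i, (∫ y in p1RealCell a h i, ω y) * (ρ i * fpFrob (p1CellGrad a h V i)) := by
  have ha' := ha.ne'
  have hh' := hh.ne'
  -- per-cell inequality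
  have hcell : ∀ i, ∑ m, p1CellBare a h W V i m ≤
      (∫ y in p1RealCell a h i, p1Quad3 (W y) (p1Field a h V y)) +
        (∫ y in p1RealCell a h i, ω y) * (ρ i * fpFrob (p1CellGrad a h V i)) := by
    intro i
    have h1 := vertex_quadrature_excess_rad_p1RealCell ha hh i W hWc (fun y _ u => hW0 y u) hωc (fun y _ u => hω y u)
      (p1CellGrad a h V i) (p1CellVals V i) (p1CellVals_sub_eq_grad ha' hh' V i) (hρ i)
    have h2 : ∫ y in p1RealCell a h i, p1Quad3 (W y) (fun k => ∑ m, p1Lam a h i m y * p1CellVals V i m k) =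
        ∫ y in p1RealCell a h i, p1Quad3 (W y) (p1Field a h V y) :=
      setIntegral_congr_fun (isClosed_p1RealCell a h i).measurableSet fun y hy => by rw [p1Field_eq_sum_p1Lam V hy]
    unfold p1CellBare
    rw [← h2]
    exact h1
  -- the three families
  have hB : HasSum (fun i => ∫ y in p1RealCell a h i, p1Quad3 (W y) (p1Field a h V y)) (∫ y, p1Quad3 (W y) (p1Field a h V y)) :=
    hasSum_setIntegral_p1RealCell ha' hh' hint
  have hA0 : ∀ i, 0 ≤ ∑ m, p1CellBare a h W V i m := fun i => Finset.sum_nonneg fun m _ => p1CellBare_nonneg V i (fun y _ u => hW0 y u) m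
  have hsum : Summable fun i => (∫ y in p1RealCell a h i, p1Quad3 (W y) (p1Field a h V y)) +
      (∫ y in p1RealCell a h i, ω y) * (ρ i * fpFrob (p1CellGrad a h V i)) := hB.summable.add hdef
  have hA : Summable fun i => ∑ m, p1CellBare a h W V i m := Summable.of_nonneg_of_le hA0 hcell hsum
  -- regroup the vertex family to sites
  have hg0 : ∀ n π m, 0 ≤ p1CellBare a h W V (n, π) m := fun n π m => p1CellBare_nonneg V (n, π) (fun y _ u => hW0 y u) m
  have hAf : HasSum (fun n : ℤ × ℤ × ℤ => ∑ π : Fin 6, ∑ m : Fin 4, p1CellBare a h W V (n, π) m) (∑' i, ∑ m, p1CellBare a h W V i m) :=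
    hA.hasSum.prod_fiberwise fun n => hasSum_fintype _
  obtain ⟨hS, hEq⟩ := tsum_cellVertex_eq_tsum_site (g := fun n π m => p1CellBare a h W V (n, π) m) hg0 hAf.summable
  have hSite : (fun q => ∑ o ∈ p1Corners, ∑ π : Fin 6, ∑ m : Fin 4,
      if p1VertOff (p1Par (q - o)) π m = o then p1CellBare a h W V (q - o, π) m else 0) = p1SiteBare a h W V := by
    funext q; rfl
  rw [hSite] at hS hEq
  refine ⟨hS, ?_⟩
  rw [← hEq, hAf.tsum_eq]
  calc ∑' i, ∑ m, p1CellBare a h W V i m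
      ≤ ∑' i, ((∫ y in p1RealCell a h i, p1Quad3 (W y) (p1Field a h V y)) +
          (∫ y in p1RealCell a h i, ω y) * (ρ i * fpFrob (p1CellGrad a h V i))) :=
        Summable.tsum_le_tsum hcell hA hsum
    _ = (∑' i, ∫ y in p1RealCell a h i, p1Quad3 (W y) (p1Field a h V y)) +
          ∑' i, (∫ y in p1RealCell a h i, ω y) * (ρ i * fpFrob (p1CellGrad a h V i)) :=
        hB.summable.tsum_add hdef
    _ = (∫ y, p1Quad3 (W y) (p1Field a h V y)) + ∑' i, (∫ y in p1RealCell a h i, ω y) * (ρ i * fpFrob (p1CellGrad a h V i)) := by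
        rw [hB.tsum_eq]

end Summit.AtomisticToContinuum.Crystallization.Theorems.StrictSplittingRuleBirth
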